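import Summits.QuantumFields.QCD.Theses.HeatSlicedQuarks

/-!
# Stub `stub_rowDiffToDiag` of line `Sketch`
(crux `Summit.QuantumFields.QCD.Theses.HeatSlicedQuarks.InterleavedHeatSliceFlow`, item stmt-QuantumFields-8891)

**Rows to diagonal** (reshape r3, an input of `stub_parametrixCore`: it turns an `ℓ²` comparison of
heat-kernel ROWS at proper time `s` into an entrywise comparison at time `2s`, via
`e^{-2sH} = e^{-sH} e^{-sH}`).  For all square complex matrices `P`, `Q` and all indices `i`, `j`,

  `‖(P P)ᵢⱼ − (Q Q)ᵢⱼ‖ ≤ ‖rowᵢ(P − Q)‖₂ ‖colⱼ P‖₂ + ‖rowᵢ Q‖₂ ‖colⱼ(P − Q)‖₂`.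

Proof (pure algebra).  `P P − Q Q = (P − Q) P + Q (P − Q)`, so entry `(i, j)` equals
`Σ_k (P i k − Q i k) P k j + Σ_k Q i k (P k j − Q k j)`, and each sum is bounded by the triangle
inequality followed by the real Cauchy–Schwarz inequality
`Σ_k ‖a k‖ ‖b k‖ ≤ √(Σ_k ‖a k‖²) √(Σ_k ‖b k‖²)` (`Real.sum_mul_le_sqrt_mul_sqrt`).
No named facts are used (Mathlib only).
-/

namespace Summit.QuantumFields.QCD.Cruxes.InterleavedHeatSliceFlow.Sketch

open Matrix

/-- Cauchy–Schwarz for a finite complex bilinear sum: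
`‖Σ_k a k * b k‖ ≤ √(Σ_k ‖a k‖²) · √(Σ_k ‖b k‖²)`. -/
private theorem rowDiffToDiag_norm_sum_mul_le {ι : Type*} [Fintype ι] (a b : ι → ℂ) :
    ‖∑ k, a k * b k‖ ≤ Real.sqrt (∑ k, ‖a k‖ ^ 2) * Real.sqrt (∑ k, ‖b k‖ ^ 2) :=
  calc ‖∑ k, a k * b k‖
      ≤ ∑ k, ‖a k * b k‖ := norm_sum_le _ _
    _ = ∑ k, ‖a k‖ * ‖b k‖ := Finset.sum_congr rfl fun _ _ => norm_mul _ _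
    _ ≤ Real.sqrt (∑ k, ‖a k‖ ^ 2) * Real.sqrt (∑ k, ‖b k‖ ^ 2) :=
        Real.sum_mul_le_sqrt_mul_sqrt _ _ _

/-- The entrywise algebraic identity `(P P − Q Q)ᵢⱼ = Σ_k (P − Q)ᵢₖ Pₖⱼ + Σ_k Qᵢₖ (P − Q)ₖⱼ`. -/
private theorem rowDiffToDiag_entry_identity {ι : Type*} [Fintype ι] (P Q : Matrix ι ι ℂ)
    (i j : ι) :
    (P * P) i j - (Q * Q) i j =
      ∑ k, (P i k - Q i k) * P k j + ∑ k, Q i k * (P k j - Q k j) := by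
  rw [mul_apply, mul_apply, ← Finset.sum_sub_distrib, ← Finset.sum_add_distrib]
  exact Finset.sum_congr rfl fun k _ => by ring

/-- **Rows to diagonal** (registered stub `stub_rowDiffToDiag` of line `Sketch`, reshape r3, input of
`stub_parametrixCore`): for all square complex matrices `P`, `Q` and indices `i`, `j`,
`‖(P P)ᵢⱼ − (Q Q)ᵢⱼ‖ ≤ √(Σ_k ‖Pᵢₖ − Qᵢₖ‖²) √(Σ_k ‖Pₖⱼ‖²) + √(Σ_k ‖Qᵢₖ‖²) √(Σ_k ‖Pₖⱼ − Qₖⱼ‖²)`.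
Indeed `P P − Q Q = (P − Q) P + Q (P − Q)` entrywise, and each of the two sums over `k` is bounded by
the triangle inequality and Cauchy–Schwarz. -/
theorem stub_rowDiffToDiag :
    ∀ (ι : Type) [Fintype ι] [DecidableEq ι] (P Q : Matrix ι ι ℂ) (i j : ι),
      ‖(P * P) i j - (Q * Q) i j‖ ≤
        Real.sqrt (∑ k, ‖P i k - Q i k‖ ^ 2) * Real.sqrt (∑ k, ‖P k j‖ ^ 2) +
          Real.sqrt (∑ k, ‖Q i k‖ ^ 2) * Real.sqrt (∑ k, ‖P k j - Q k j‖ ^ 2) := by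
  intro ι _ _ P Q i j
  rw [rowDiffToDiag_entry_identity]
  exact (norm_add_le _ _).trans (add_le_add (rowDiffToDiag_norm_sum_mul_le _ _)
    (rowDiffToDiag_norm_sum_mul_le _ _))

end Summit.QuantumFields.QCD.Cruxes.InterleavedHeatSliceFlow.Sketch
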